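import Mathlib.Algebra.Polynomial.Homogenize
import Literature.NumberTheory.EllipticCurves.HasseManin
import Literature.NumberTheory.EllipticCurves.FunctionFieldTranslation
import Literature.NumberTheory.EllipticCurves.FrobeniusSeparableProofs
import HarnessLib

/-!
# `π² - aπ + q = 0` for the Frobenius of an elliptic curve over a finite field, by Manin's method

Topic `NumberTheory/EllipticCurves` (trunk T-ELLARITH). A theorems-only companion of the
Hasse–Manin files (`HasseManinFunctionField`, `HasseManinPolynomials`, `HasseManin`) proving
**Silverman, *AEC*, Thm. V.2.3.1(b)**: for an elliptic curve `E = W` over a finite field `k` with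
`q` elements, the `q`-power Frobenius endomorphism `π` satisfies

  `π² - aπ + q = 0` in `End_k(E)`,  `a = q + 1 - #E(k)`

(`WeierstrassCurve.aeval_frobeniusIsogeny_eq_zero`, for the tree's `frobeniusIsogeny` and
`endRing`; pointwise form `WeierstrassCurve.frobenius_sq_sub_trace_smul_add_card_smul`:
`σ_q² T - a • σ_q T + q • T = O` for all `T ∈ E(k̄)`). In particular `π` is algebraic over `ℤ`,
which is the one geometric input of Tate's semisimplicity theorem for `V_ℓ E` as assembled in
`Literature.AlgebraicGeometry.Motives.FaltingsECSemisimpleProofs`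
(`isSemisimpleRepresentation_rationalGaloisRepTate_of_exists_aeval_eq_zero`); the discharge
`Literature.AlgebraicGeometry.Motives.isSemisimpleRepresentation_rationalGaloisRepTate_of_finite_holds` of the named fact
`Literature.AlgebraicGeometry.Motives.isSemisimpleRepresentation_rationalGaloisRepTate_of_finite` of `FaltingsEC`
(Tate 1966, Main Theorem: `V_ℓ E` is a semisimple `ℚ_ℓ[Γ_k]`-module, every prime `ℓ`) follows
in `Literature.AlgebraicGeometry.Motives.FaltingsECSemisimpleFiniteProofs`.

Silverman derives V.2.3.1(b) from `det(φ_ℓ) = deg φ` on the Tate module (III.8.6, Weil pairing and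
dual isogeny), none of which the tree has. The proof here is **elementary**: it extends Manin's
1956 degree argument for Hasse's theorem (as formalised in `HasseManin`: `st_all`, the degree
`d(n) = n² + an + q` of `x(P₀ + n Q)`) from the line `{φ + n}` to the point `φ² - aφ + q` of
`End(E)`, using only the basic identity `step` of `HasseManin` (stated there for a general
point), compositions of rational maps realised as `k`-algebra endomorphisms of `k(E)` (the
tree's `funcAlgHom` of `FunctionFieldTranslation`), and the translation automorphisms of `K̄(E)`
(`transAlgHom`, ibid.) to pass from the generic point to all points.

## The argument

Notation of `HasseManinFunctionField`: `L = k(W)`, `Q = (t, s)` the generic point,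
`P₀ = (t^q, s^q)`, `P_n = P₀ + n • Q` (the generic value of `φ + n`), `d(n) = dg W n = n² + a n + q`
the degree of the reduced numerator of `x(P_n)` (`st_all`; `d(n) = 0` iff `P_n = O`). Put
`P₀' = (t^{q²}, s^{q²})` (`= Point.map frob P₀`, the generic value of `φ²`).

1. **Compositions** (`map_funcAlgHom_maninPt`, `exists_repDeg_comp`). For `P_m = (x_m, y_m) ≠ O`
   the `k`-algebra map `θ_m : L → L`, `t ↦ x_m, s ↦ y_m` (`funcAlgHom`; `x_m` is transcendental,
   being a rational function of positive degree, `transcendental_of_isRep`) induces a group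
   homomorphism of `W(L)` with `Q ↦ P_m`, `P₀ ↦ Frob(P_m) = P₀' + m • P₀`, hence
   `P_n ↦ P₀' + (m + n) • P₀ + (n m) • Q` — the generic value of `(φ + n) ∘ (φ + m)`. Its
   `x`-coordinate is `x_n(x_m)`, i.e. `b^d a_n(a_m/b_m) / b^d b_n(a_m/b_m)` for `x_n = a_n/b_n`,
   `x_m = a_m/b_m` reduced (`d = deg a_n`): again reduced, with numerator of degree `d(n) d(m)`
   exceeding that of the denominator (`isRep_of_mul_aeval_eq`; homogenised evaluation via
   Mathlib's `Polynomial.homogenize`, coprimality by Bezout).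
2. **Recursion** (`repDeg_step`, `exists_repDeg_fun`, `exists_eq_quadratic_of_rec`). Along any
   sequence `p ↦ R + p • Q` whose `x`-coordinates lie in `k(X)` (here `R = P₀' + s • P₀`, on
   which the negation involution acts as `-1`, `negL_xc_frobPt₂`), Manin's basic identity
   (`step` of `HasseManin`, with the degenerate cases `O, ±Q` as in `st_step`) propagates the
   invariant "`x = a/b` reduced with `deg b < deg a`" from one index to all, and the numerator
   degrees `e(p)` satisfy `e(p + 1) + e(p - 1) = 2 e(p) + 2`, so `e(p) = p² + c₁ p + c₀`.
3. **Interpolation** (`frob_relation`). On the line `s = -a` the anchors of step 1 sit at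
   `p = n(-a - n)` with `e = d(n) d(-a - n) = d(n)² = (p - q)²`; two of them (`n = 0` and
   `n = ±1`) force `e(p) = (p - q)²`, so `e(q) = 0`, i.e. **`P₀' - a • P₀ + q • Q = O` in `W(L)`**
   (if some `P_n = O`, i.e. `φ ∈ ℤ`, the identity reads `d(n) • Q = O`). The underlying algebra:
   `d(n) d(m)`, as a function of `(s, p) = (n + m, n m)`, is the quadratic
   `p² + (a s + a² - 2q) p + (q s² + a q s + q²)`, which vanishes at `(s, p) = (-a, q)`.
4. **Specialisation** (`frobeniusPoint_genericPoint_relation`,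
   `frobenius_sq_sub_trace_smul_add_card_smul`). Along `k(E) → K̄(E)` (the `funcAlgHom` of the
   generic point `(x, y)` of `FunctionFieldTranslation`) the identity becomes
   `Frob²(x, y) - a • Frob(x, y) + q • (x, y) = O` in `E(K̄(E))`; applying the translation
   `τ_T^*` (`transAlgHom T`: it maps `(x, y) ↦ (x, y) + T`, commutes with `Frob`, and `Frob`
   of the constant point `T` is the constant point `σ_q • T`) and subtracting,
   `σ_q² T - a • σ_q T + q • T = O` for every `T ∈ E(k̄)` (`constPoint` is injective).

## References

* [SilvermanAEC2009] J. H. Silverman, *The Arithmetic of Elliptic Curves*, 2nd ed., GTM 106,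
  Springer 2009: Thm. V.2.3.1(b) (`φ² - aφ + q = 0`), V.§1–2.
* [Tate1966Endomorphisms] J. Tate, *Endomorphisms of abelian varieties over finite fields*,
  Invent. Math. 2 (1966), 134–144: Main Theorem, §2 (`π` acts semisimply on `V_ℓ`).
* Yu. I. Manin, *On cubic congruences to a prime modulus*, Izv. Akad. Nauk SSSR 20 (1956).
* [Chahal2021] J. S. Chahal, *Algebraic Number Theory: A Brief Introduction*, CRC Press 2021,
  §10.3, (10.25) and Thm. 10.14 (Manin's basic identity and `d_n = n² + a_q n + q`).
* [ChahalSoomroTop2014] J. S. Chahal, A. Soomro, J. Top, *A supplement to Manin's proof of the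
  Hasse inequality*, Rocky Mountain J. Math. 44 (2014), §1 (`P_n` corresponds to `φ + n`).

## Design

Theorems only (no definitions): the invariant "`P = O` and `d = 0`, or `P ≠ O` and
`x(P) = a/b` reduced with `deg b < deg a = d`" (`St` of `HasseManinFunctionField` with the degree
freed) is written out in each statement; the pull-backs `θ_m` and the embedding `k(E) → K̄(E)` are
the tree's `Literature.NumberTheory.EllipticCurves.WeierstrassFunctionField.funcAlgHom` applied to explicit points, and the Frobenius
maps on points are `Point.map (Literature.HasseManin.frob W)` over `k(E)` and the tree's
`WeierstrassCurve.frobeniusPoint` over `K̄(E)`. `noncomputable section`, universe-monomorphic base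
field as in the files it extends; namespaces `Literature.HasseManin` (function-field part),
`WeierstrassCurve` (dot-notation extensions: points of `E(k̄)` and `End_k(E)`).
-/

noncomputable section

open Polynomial WeierstrassCurve WeierstrassCurve.Affine
open scoped Polynomial.Bivariate

universe u

namespace Literature.NumberTheory.EllipticCurves.HasseManin

variable {F : Type u} [Field F]

/-! ## Homogenised evaluation `b^D · p(a/b)` -/

section Homogenize

/-- `p.homogenize D = p.homogenize (deg p) · X₁ ^ (D - deg p)` for `D ≥ deg p`. [folklore] -/
theorem homogenize_eq_mul_X_pow (p : F[X]) {D : ℕ} (hD : p.natDegree ≤ D) :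
    p.homogenize D = p.homogenize p.natDegree * MvPolynomial.X 1 ^ (D - p.natDegree) := by
  have h := homogenize_mul p 1 (m := p.natDegree) (n := D - p.natDegree) le_rfl (by simp)
  rwa [mul_one, Nat.add_sub_cancel' hD, homogenize_one] at h

/-- Degree bound: `deg (b^D p(a/b)) ≤ D · deg a` when `deg b ≤ deg a` and `deg p ≤ D`. [folklore] -/
theorem natDegree_aeval_homogenize_le {a b : F[X]} (hab : b.natDegree ≤ a.natDegree) {D : ℕ}
    (p : F[X]) (hp : p.natDegree ≤ D) :
    (MvPolynomial.aeval ![a, b] (p.homogenize D)).natDegree ≤ D * a.natDegree := by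
  refine Polynomial.induction_with_natDegree_le
    (fun p ↦ (MvPolynomial.aeval ![a, b] (p.homogenize D)).natDegree ≤ D * a.natDegree) D
    (by simp) ?_ ?_ p hp
  · intro n r hr hn
    rw [homogenize_C_mul, homogenize_X_pow hn, map_mul, map_mul, map_pow, map_pow,
      MvPolynomial.aeval_C, MvPolynomial.aeval_X, MvPolynomial.aeval_X]
    simp only [Matrix.cons_val_zero, Matrix.cons_val_one]
    calc (algebraMap F F[X] r * (a ^ n * b ^ (D - n))).natDegree
        ≤ (algebraMap F F[X] r).natDegree + (a ^ n * b ^ (D - n)).natDegree := natDegree_mul_le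
      _ ≤ 0 + (n * a.natDegree + (D - n) * b.natDegree) := by
          gcongr
          · rw [Polynomial.algebraMap_eq, natDegree_C]
          · exact natDegree_mul_le.trans (add_le_add natDegree_pow_le natDegree_pow_le)
      _ ≤ 0 + (n * a.natDegree + (D - n) * a.natDegree) := by gcongr
      _ = D * a.natDegree := by rw [zero_add, ← add_mul, Nat.add_sub_cancel' hn]
  · intro f g _ _ hf hg
    rw [homogenize_add, map_add]
    exact (natDegree_add_le _ _).trans (max_le hf hg)

/-- Splitting off the top term: `b^d p(a/b) = E · b + lead(p) · a^d` (`d = deg p ≥ 1`), with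
`deg E ≤ (d - 1) deg a` when `deg b ≤ deg a`. [folklore] -/
theorem exists_aeval_homogenize_eq {a b : F[X]} (hab : b.natDegree ≤ a.natDegree) {p : F[X]}
    (hd : 1 ≤ p.natDegree) :
    ∃ E : F[X], MvPolynomial.aeval ![a, b] (p.homogenize p.natDegree) =
        E * b + C p.leadingCoeff * a ^ p.natDegree ∧
      E.natDegree ≤ (p.natDegree - 1) * a.natDegree := by
  have he : p.eraseLead.natDegree ≤ p.natDegree - 1 := eraseLead_natDegree_le p
  refine ⟨MvPolynomial.aeval ![a, b] (p.eraseLead.homogenize (p.natDegree - 1)), ?_,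
    natDegree_aeval_homogenize_le hab _ he⟩
  have h1 : p.eraseLead.homogenize p.natDegree =
      p.eraseLead.homogenize (p.natDegree - 1) * MvPolynomial.X 1 := by
    have h := homogenize_mul p.eraseLead 1 (m := p.natDegree - 1) (n := 1) he (by simp)
    rwa [mul_one, Nat.sub_add_cancel hd, homogenize_one, pow_one] at h
  have h2 : p.homogenize p.natDegree = p.eraseLead.homogenize p.natDegree +
      MvPolynomial.C p.leadingCoeff * MvPolynomial.X 0 ^ p.natDegree := by
    have h : (p.eraseLead + C p.leadingCoeff * X ^ p.natDegree).homogenize p.natDegree =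
        p.homogenize p.natDegree :=
      congrArg (fun s ↦ Polynomial.homogenize s p.natDegree) (eraseLead_add_C_mul_X_pow p)
    rw [← h, homogenize_add, homogenize_C_mul, homogenize_X_pow le_rfl, Nat.sub_self, pow_zero,
      mul_one]
  rw [h2, h1, map_add, map_mul, map_mul, map_pow, MvPolynomial.aeval_C, MvPolynomial.aeval_X,
    MvPolynomial.aeval_X, Polynomial.algebraMap_eq]
  simp only [Matrix.cons_val_zero, Matrix.cons_val_one]

/-- **Exact degree**: `deg (b^d p(a/b)) = d · deg a` for `p ≠ 0`, `d = deg p`, `deg b < deg a`; in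
particular `b^d p(a/b) ≠ 0`. [folklore] -/
theorem natDegree_aeval_homogenize {a b : F[X]} (hab : b.natDegree < a.natDegree) {p : F[X]}
    (hp : p ≠ 0) :
    (MvPolynomial.aeval ![a, b] (p.homogenize p.natDegree)).natDegree = p.natDegree * a.natDegree ∧
      MvPolynomial.aeval ![a, b] (p.homogenize p.natDegree) ≠ 0 := by
  rcases Nat.eq_zero_or_pos p.natDegree with hd | hd
  · rw [hd]
    obtain ⟨c, hc⟩ : ∃ c, p = C c := ⟨_, eq_C_of_natDegree_eq_zero hd⟩
    have hc0 : c ≠ 0 := by rintro rfl; exact hp (by rw [hc, C_0])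
    rw [hc, homogenize_C, pow_zero, mul_one, MvPolynomial.aeval_C, Polynomial.algebraMap_eq,
      natDegree_C, zero_mul]
    exact ⟨rfl, C_ne_zero.mpr hc0⟩
  · obtain ⟨E, hE, hEdeg⟩ := exists_aeval_homogenize_eq hab.le hd
    have ha : a ≠ 0 := by rintro rfl; simp at hab
    have htop : (C p.leadingCoeff * a ^ p.natDegree).natDegree = p.natDegree * a.natDegree := by
      rw [natDegree_C_mul (leadingCoeff_ne_zero.mpr hp), natDegree_pow]
    have hlt : (E * b).natDegree < (C p.leadingCoeff * a ^ p.natDegree).natDegree := by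
      rw [htop]
      calc (E * b).natDegree ≤ E.natDegree + b.natDegree := natDegree_mul_le
        _ ≤ (p.natDegree - 1) * a.natDegree + b.natDegree := by gcongr
        _ < (p.natDegree - 1) * a.natDegree + a.natDegree := by gcongr
        _ = p.natDegree * a.natDegree := by
            rw [← Nat.succ_mul, Nat.sub_one, Nat.succ_pred_eq_of_pos hd]
    rw [hE, natDegree_add_eq_right_of_natDegree_lt hlt, htop]
    refine ⟨rfl, fun h0 ↦ ?_⟩
    have := congrArg natDegree h0
    rw [natDegree_add_eq_right_of_natDegree_lt hlt, htop, natDegree_zero] at this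
    exact (Nat.mul_pos hd (Nat.pos_of_ne_zero fun h ↦ by omega)).ne' this

/-- `b^d p(a/b)` is coprime to `b` (`d = deg p`, `a, b` coprime, `p ≠ 0`). [folklore] -/
theorem isCoprime_aeval_homogenize_right {a b : F[X]} (hab : b.natDegree ≤ a.natDegree)
    (hcop : IsCoprime a b) {p : F[X]} (hp : p ≠ 0) :
    IsCoprime (MvPolynomial.aeval ![a, b] (p.homogenize p.natDegree)) b := by
  rcases Nat.eq_zero_or_pos p.natDegree with hd | hd
  · rw [hd]
    obtain ⟨c, hc⟩ : ∃ c, p = C c := ⟨_, eq_C_of_natDegree_eq_zero hd⟩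
    have hc0 : c ≠ 0 := by rintro rfl; exact hp (by rw [hc, C_0])
    rw [hc, homogenize_C, pow_zero, mul_one, MvPolynomial.aeval_C, Polynomial.algebraMap_eq]
    exact isCoprime_one_left.of_isCoprime_of_dvd_left (isUnit_C.mpr (isUnit_iff_ne_zero.mpr hc0)).dvd
  · obtain ⟨E, hE, -⟩ := exists_aeval_homogenize_eq hab hd
    rw [hE, add_comm]
    refine IsCoprime.add_mul_right_left ?_ E
    refine IsCoprime.mul_left ?_ (hcop.pow_left)
    exact isCoprime_one_left.of_isCoprime_of_dvd_left
      (isUnit_C.mpr (isUnit_iff_ne_zero.mpr (leadingCoeff_ne_zero.mpr hp))).dvd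

/-- **Bezout after homogenisation**: if `p, r` are coprime then for `D ≥ deg r` there are `U, V, N`
with `U · b^d p(a/b) + V · b^D r(a/b) = b^N` (`d = deg p`). [folklore] -/
theorem exists_mul_aeval_homogenize_add_eq_pow {a b p r : F[X]} (hpr : IsCoprime p r) {D : ℕ}
    (hD : r.natDegree ≤ D) :
    ∃ U V : F[X], ∃ N : ℕ, U * MvPolynomial.aeval ![a, b] (p.homogenize p.natDegree) +
      V * MvPolynomial.aeval ![a, b] (r.homogenize D) = b ^ N := by
  obtain ⟨u, v, huv⟩ := hpr
  set N := u.natDegree + v.natDegree + p.natDegree + D with hN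
  have hu : u.natDegree ≤ N - p.natDegree := by omega
  have hv : v.natDegree ≤ N - D := by omega
  have h1 : (u * p).homogenize N =
      u.homogenize (N - p.natDegree) * p.homogenize p.natDegree := by
    have h := homogenize_mul u p hu le_rfl
    rwa [Nat.sub_add_cancel (by omega : p.natDegree ≤ N)] at h
  have h2 : (v * r).homogenize N = v.homogenize (N - D) * r.homogenize D := by
    have h := homogenize_mul v r hv hD
    rwa [Nat.sub_add_cancel (by omega : D ≤ N)] at h
  have h := congrArg (fun s ↦ MvPolynomial.aeval ![a, b] (s.homogenize N)) huv
  simp only [homogenize_add, h1, h2, homogenize_one, map_add, map_mul, map_pow,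
    MvPolynomial.aeval_X, Matrix.cons_val_one] at h
  exact ⟨_, _, N, h⟩

/-- **`b^d p(a/b)` and `b^D r(a/b)` are coprime** for coprime `p ≠ 0`, `r` and coprime `a, b` with
`deg b ≤ deg a` (`d = deg p`, `D ≥ deg r`). [folklore] -/
theorem isCoprime_aeval_homogenize {a b p r : F[X]} (hab : b.natDegree ≤ a.natDegree)
    (hcop : IsCoprime a b) (hpr : IsCoprime p r) (hp : p ≠ 0) {D : ℕ} (hD : r.natDegree ≤ D) :
    IsCoprime (MvPolynomial.aeval ![a, b] (p.homogenize p.natDegree))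
      (MvPolynomial.aeval ![a, b] (r.homogenize D)) := by
  obtain ⟨U, V, N, hUV⟩ := exists_mul_aeval_homogenize_add_eq_pow (a := a) (b := b) hpr hD
  obtain ⟨s, t, hst⟩ := (isCoprime_aeval_homogenize_right hab hcop hp).pow_right (n := N)
  rw [← hUV] at hst
  exact ⟨s + t * U, t * V, by linear_combination hst⟩

/-- **Degree of the homogenised denominator**: `deg (b^d r(a/b)) < d · deg a` for `deg r < d` and
`deg b < deg a`. [folklore] -/
theorem natDegree_aeval_homogenize_lt {a b r : F[X]} (hab : b.natDegree < a.natDegree) {d : ℕ}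
    (hr : r.natDegree < d) :
    (MvPolynomial.aeval ![a, b] (r.homogenize d)).natDegree < d * a.natDegree := by
  rw [homogenize_eq_mul_X_pow r hr.le, map_mul, map_pow, MvPolynomial.aeval_X]
  simp only [Matrix.cons_val_one]
  calc (MvPolynomial.aeval ![a, b] (r.homogenize r.natDegree) * b ^ (d - r.natDegree)).natDegree
      ≤ (MvPolynomial.aeval ![a, b] (r.homogenize r.natDegree)).natDegree +
          (b ^ (d - r.natDegree)).natDegree := natDegree_mul_le
    _ ≤ r.natDegree * a.natDegree + (d - r.natDegree) * b.natDegree :=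
        add_le_add (natDegree_aeval_homogenize_le hab.le r le_rfl) natDegree_pow_le
    _ < r.natDegree * a.natDegree + (d - r.natDegree) * a.natDegree :=
        Nat.add_lt_add_left (Nat.mul_lt_mul_of_pos_left hab (by omega)) _
    _ = d * a.natDegree := by rw [← add_mul, Nat.add_sub_cancel' hr.le]

end Homogenize

/-! ## Homogenised evaluation in the function field -/

section FunctionField

variable (W : WeierstrassCurve F)

/-- **`b^D p(a/b)` in `F(W)`**: the image of the homogenised evaluation is `p(a/b) · b^D`
(`D ≥ deg p`, `b ≠ 0`). [folklore] -/
theorem algebraMap_aeval_homogenize {a b : F[X]} (hb : b ≠ 0) (p : F[X]) {D : ℕ}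
    (hD : p.natDegree ≤ D) :
    algebraMap F[X] W.toAffine.FunctionField (MvPolynomial.aeval ![a, b] (p.homogenize D)) =
      aeval (algebraMap F[X] W.toAffine.FunctionField a / algebraMap F[X] _ b) p *
        algebraMap F[X] W.toAffine.FunctionField b ^ D := by
  set L := W.toAffine.FunctionField
  have hbL : algebraMap F[X] L b ≠ 0 :=
    (map_ne_zero_iff _ (algebraMap_functionField_injective W)).mpr hb
  have h1 : algebraMap F[X] L (MvPolynomial.aeval ![a, b] (p.homogenize D)) =
      MvPolynomial.aeval ![algebraMap F[X] L a, algebraMap F[X] L b] (p.homogenize D) := by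
    have hv : (fun i ↦ (IsScalarTower.toAlgHom F F[X] L) (![a, b] i)) =
        ![algebraMap F[X] L a, algebraMap F[X] L b] := by
      funext i
      fin_cases i <;> rfl
    change (IsScalarTower.toAlgHom F F[X] L) (MvPolynomial.aeval ![a, b] (p.homogenize D)) = _
    rw [← AlgHom.comp_apply, MvPolynomial.comp_aeval, hv]
  rw [h1, MvPolynomial.aeval_def, MvPolynomial.eval₂_eq_eval_map, ← homogenize_map,
    eval_homogenize ((natDegree_map_le).trans hD) _ (by simpa using hbL)]
  simp only [Matrix.cons_val_zero, Matrix.cons_val_one]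
  rw [eval_map_algebraMap]

/-- **A rational function `a/b ∈ F(X) ⊆ F(W)` with `deg b < deg a` is transcendental over `F`.**
[folklore] -/
theorem transcendental_of_isRep {z : W.toAffine.FunctionField} {a b : F[X]} (hz : IsRep W z a b)
    (hab : b.natDegree < a.natDegree) : Transcendental F z := by
  rintro ⟨p, hp, hpz⟩
  have h := algebraMap_aeval_homogenize W (a := a) hz.ne_zero p le_rfl
  rw [← hz.eq_div, hpz, zero_mul, map_eq_zero_iff _ (algebraMap_functionField_injective W)] at h
  exact (natDegree_aeval_homogenize hab hp).2 h

/-- **Composition of reduced fractions.** If `z = a/b` in lowest terms with `deg b < deg a`, and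
`w · r(z) = p(z)` with `p ≠ 0`, `r` coprime of degrees `deg r < deg p`, then
`w = b^d p(a/b) / b^d r(a/b)` in lowest terms (`d = deg p`), the numerator has degree `d · deg a` and
the denominator has smaller degree. This computes `x(ψ ∘ φ) = x_ψ(x_φ)` for maps `φ, ψ : W → W`
whose `x`-coordinates are the rational functions `a/b` and `p/r`. [folklore] -/
theorem isRep_of_mul_aeval_eq {z w : W.toAffine.FunctionField} {a b p r : F[X]} (hz : IsRep W z a b)
    (hab : b.natDegree < a.natDegree) (hpr : IsCoprime p r) (hp : p ≠ 0) (hr : r ≠ 0)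
    (hrp : r.natDegree < p.natDegree) (hw : w * aeval z r = aeval z p) :
    IsRep W w (MvPolynomial.aeval ![a, b] (p.homogenize p.natDegree))
        (MvPolynomial.aeval ![a, b] (r.homogenize p.natDegree)) ∧
      (MvPolynomial.aeval ![a, b] (r.homogenize p.natDegree)).natDegree <
        (MvPolynomial.aeval ![a, b] (p.homogenize p.natDegree)).natDegree ∧
      (MvPolynomial.aeval ![a, b] (p.homogenize p.natDegree)).natDegree =
        p.natDegree * a.natDegree := by
  have hzt := transcendental_of_isRep W hz hab
  have hdeg := natDegree_aeval_homogenize hab hp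
  refine ⟨⟨?_, isCoprime_aeval_homogenize hab.le hz.isCoprime hpr hp hrp.le, ?_⟩, ?_, hdeg.1⟩
  · intro h0
    have h := algebraMap_aeval_homogenize W (a := a) hz.ne_zero r hrp.le
    rw [h0, map_zero, ← hz.eq_div, zero_eq_mul] at h
    rcases h with h | h
    · exact hr ((transcendental_iff_injective.mp hzt) (by rwa [map_zero]))
    · exact hz.ne_zero ((map_eq_zero_iff _ (algebraMap_functionField_injective W)).mp
        (pow_eq_zero_iff' .. |>.mp h).1)
  · rw [algebraMap_aeval_homogenize W (a := a) hz.ne_zero r hrp.le,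
      algebraMap_aeval_homogenize W (a := a) hz.ne_zero p le_rfl, ← hz.eq_div, ← mul_assoc, hw]
  · rw [hdeg.1]
    exact natDegree_aeval_homogenize_lt hab hrp

end FunctionField

/-! ## Pull-back maps of affine points of `W(F(W))` and the Frobenius on points -/

section PointMaps

variable (W : WeierstrassCurve F) [W.IsElliptic]

omit [W.IsElliptic] in
/-- The Weierstrass equation of a point of `W` over an `F`-field `L'`, in `evalEval` form over the
coefficient map `F → L'`. [folklore] -/
theorem evalEval_eq_zero_of_nonsingular {L' : Type*} [Field L'] [Algebra F L'] {x y : L'}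
    (h : (W.baseChange L').toAffine.Nonsingular x y) :
    (W.toAffine.polynomial.map (mapRingHom (algebraMap F L'))).evalEval x y = 0 := by
  have e : (W.baseChange L').toAffine.polynomial =
      W.toAffine.polynomial.map (mapRingHom (algebraMap F L')) :=
    Affine.map_polynomial W.toAffine (algebraMap F L')
  rw [← e]
  exact h.left

omit [W.IsElliptic] in
/-- **The pull-back `θ_P : F(W) → F(W)` of an affine point `P = (x, y) ∈ W(F(W))` with `x`
transcendental over `F`** (`t ↦ x`, `s ↦ y`; the tree's `funcAlgHom`) sends `t ↦ x`. For `P` the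
generic value of a rational map `φ : W ⇢ W` this is `φ^*`. [folklore] -/
theorem funcAlgHom_gT {x y : W.toAffine.FunctionField}
    (h : (W.baseChange W.toAffine.FunctionField).toAffine.Nonsingular x y) (ht : Transcendental F x) :
    WeierstrassFunctionField.funcAlgHom (V := W.toAffine) x y (evalEval_eq_zero_of_nonsingular W h) ht
      (gT W) = x :=
  WeierstrassFunctionField.funcAlgHom_xF _ _ _ _

omit [W.IsElliptic] in
/-- `θ_P` sends `s ↦ y`. [folklore] -/
theorem funcAlgHom_gS {x y : W.toAffine.FunctionField}
    (h : (W.baseChange W.toAffine.FunctionField).toAffine.Nonsingular x y) (ht : Transcendental F x) :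
    WeierstrassFunctionField.funcAlgHom (V := W.toAffine) x y (evalEval_eq_zero_of_nonsingular W h) ht
      (gS W) = y :=
  WeierstrassFunctionField.funcAlgHom_yF _ _ _ _

omit [W.IsElliptic] in
/-- `θ_P` acts on `F[X] ⊆ F(W)` by `p(t) ↦ p(x)`. [folklore] -/
theorem funcAlgHom_algebraMap {x y : W.toAffine.FunctionField}
    (h : (W.baseChange W.toAffine.FunctionField).toAffine.Nonsingular x y) (ht : Transcendental F x)
    (p : F[X]) :
    WeierstrassFunctionField.funcAlgHom (V := W.toAffine) x y (evalEval_eq_zero_of_nonsingular W h) ht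
      (algebraMap F[X] W.toAffine.FunctionField p) = aeval x p := by
  rw [← aeval_gT, ← Polynomial.aeval_algHom_apply, funcAlgHom_gT W h ht]

/-- **`θ_P` maps the generic point `Q = (t, s)` to `P`.** [folklore] -/
theorem map_funcAlgHom_genPt {x y : W.toAffine.FunctionField}
    (h : (W.baseChange W.toAffine.FunctionField).toAffine.Nonsingular x y) (ht : Transcendental F x) :
    Point.map (WeierstrassFunctionField.funcAlgHom (V := W.toAffine) x y
      (evalEval_eq_zero_of_nonsingular W h) ht) (genPt W) = .some x y h := by
  rw [genPt_eq, Point.map_some]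
  congr 1
  · exact funcAlgHom_gT W h ht
  · exact funcAlgHom_gS W h ht

variable [Fintype F]

/-- **The Frobenius on points maps `Q = (t, s)` to `P₀ = (t^q, s^q)`.** [folklore] -/
theorem map_frob_genPt : Point.map (frob W) (genPt W) = frobPt W := rfl

/-- **`θ_P` maps the Frobenius point `P₀ = (t^q, s^q)` to the Frobenius twist `(x^q, y^q)` of
`P`.** [folklore] -/
theorem map_funcAlgHom_frobPt {x y : W.toAffine.FunctionField}
    (h : (W.baseChange W.toAffine.FunctionField).toAffine.Nonsingular x y) (ht : Transcendental F x) :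
    Point.map (WeierstrassFunctionField.funcAlgHom (V := W.toAffine) x y
      (evalEval_eq_zero_of_nonsingular W h) ht) (frobPt W) = Point.map (frob W) (.some x y h) := by
  rw [frobPt_eq, Point.map_some, Point.map_some]
  congr 1
  · rw [map_pow, funcAlgHom_gT W h ht]; rfl
  · rw [map_pow, funcAlgHom_gS W h ht]; rfl

/-- **Composition of Manin's points.** For `P_m = (x_m, y_m) ≠ O` (with `x_m` transcendental) the
pull-back `θ_{P_m}` maps `P_n = P₀ + n • Q` to `P₀' + (m + n) • P₀ + (n m) • Q`, where
`P₀' = (t^{q²}, s^{q²})` is the Frobenius twist of `P₀`: on endomorphisms,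
`(φ + n) ∘ (φ + m) = φ² + (m + n) φ + n m`. [folklore] -/
theorem map_funcAlgHom_maninPt {m : ℤ} {x y : W.toAffine.FunctionField}
    {h : (W.baseChange W.toAffine.FunctionField).toAffine.Nonsingular x y}
    (hm : maninPt W m = .some x y h) (ht : Transcendental F x) (n : ℤ) :
    Point.map (WeierstrassFunctionField.funcAlgHom (V := W.toAffine) x y
      (evalEval_eq_zero_of_nonsingular W h) ht) (maninPt W n) =
      Point.map (frob W) (frobPt W) + (m + n) • frobPt W + (n * m) • genPt W := by
  rw [maninPt, map_add, map_zsmul, map_funcAlgHom_frobPt W h ht, map_funcAlgHom_genPt W h ht, ← hm,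
    maninPt,
    map_add, map_zsmul, map_frob_genPt, add_zsmul, zsmul_add, mul_zsmul]
  abel

omit [W.IsElliptic] in
/-- The negation involution commutes with the Frobenius on points. [folklore] -/
theorem map_negL_map_frob (P : (W.baseChange W.toAffine.FunctionField).toAffine.Point) :
    Point.map (negL W : W.toAffine.FunctionField →ₐ[F[X]] W.toAffine.FunctionField)
        (Point.map (frob W) P) =
      Point.map (frob W)
        (Point.map (negL W : W.toAffine.FunctionField →ₐ[F[X]] W.toAffine.FunctionField) P) := by
  rcases P with _ | ⟨x₁, y₁, h₁⟩
  · rfl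
  · simp only [Point.map_some]
    congr 1
    · exact negL_pow_card W x₁
    · exact negL_pow_card W y₁

/-- The negation involution acts as `-1` on `P₀' = (t^{q²}, s^{q²})`. [folklore] -/
theorem map_negL_map_frob_frobPt :
    Point.map (negL W : W.toAffine.FunctionField →ₐ[F[X]] W.toAffine.FunctionField)
        (Point.map (frob W) (frobPt W)) = -Point.map (frob W) (frobPt W) := by
  rw [map_negL_map_frob, map_negL_frobPt, map_neg]

/-- **The `x`-coordinates of the points `P₀' + s • P₀ + p • Q` lie in `F(X)`** (they are fixed by
the negation involution, which acts as `-1` on `Q`, `P₀`, `P₀'`). [folklore] -/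
theorem negL_xc_frobPt₂ (s p : ℤ) :
    negL W (xc W (Point.map (frob W) (frobPt W) + s • frobPt W + p • genPt W)) =
      xc W (Point.map (frob W) (frobPt W) + s • frobPt W + p • genPt W) := by
  have h : Point.map (negL W : W.toAffine.FunctionField →ₐ[F[X]] W.toAffine.FunctionField)
      (Point.map (frob W) (frobPt W) + s • frobPt W + p • genPt W) =
      -(Point.map (frob W) (frobPt W) + s • frobPt W + p • genPt W) := by
    rw [map_add, map_add, map_zsmul, map_zsmul, map_negL_map_frob_frobPt, map_negL_frobPt,
      map_negL_genPt, neg_add, neg_add, zsmul_neg, zsmul_neg]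
  have h' := congrArg (xc W) h
  rwa [xc_neg, xc_map] at h'

end PointMaps

/-! ## Manin's recursion along `p ↦ R + p • Q` for a general starting point

The induction invariant of `HasseManin` part V with the degree as a free parameter:
`RepDeg P d` (written out in each statement, this file adds no definitions) says that either
`P = O` and `d = 0`, or `P ≠ O` and `x(P) = a/b ∈ F(X)` in lowest terms with `deg b < deg a = d`. -/

section Recursion

variable (W : WeierstrassCurve F) [W.IsElliptic]

omit [W.IsElliptic] in
/-- The degree in `RepDeg P d` is determined by `P`. [folklore] -/
theorem repDeg_unique {P : (W.baseChange W.toAffine.FunctionField).toAffine.Point} {d d' : ℕ}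
    (h : (P = 0 ∧ d = 0) ∨ (P ≠ 0 ∧ ∃ a b : F[X], IsRep W (xc W P) a b ∧
      b.natDegree < a.natDegree ∧ a.natDegree = d))
    (h' : (P = 0 ∧ d' = 0) ∨ (P ≠ 0 ∧ ∃ a b : F[X], IsRep W (xc W P) a b ∧
      b.natDegree < a.natDegree ∧ a.natDegree = d')) : d = d' := by
  rcases h with ⟨hP, hd⟩ | ⟨hP, a, b, hab, -, hd⟩ <;>
    rcases h' with ⟨hP', hd'⟩ | ⟨hP', a', b', hab', -, hd'⟩
  · rw [hd, hd']
  · exact absurd hP hP'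
  · exact absurd hP' hP
  · rw [← hd, ← hd', (hab.natDegree_eq hab').1]

/-- `RepDeg Q 1`: `x(Q) = X/1`. [folklore] -/
theorem repDeg_genPt : (genPt W = 0 ∧ (1 : ℕ) = 0) ∨ (genPt W ≠ 0 ∧ ∃ a b : F[X],
    IsRep W (xc W (genPt W)) a b ∧ b.natDegree < a.natDegree ∧ a.natDegree = 1) :=
  Or.inr ⟨genPt_ne_zero W, X, 1, isRep_xc_genPt W, by rw [natDegree_one, natDegree_X]; exact one_pos,
    natDegree_X⟩

/-- `RepDeg (-Q) 1`: `x(-Q) = X/1`. [folklore] -/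
theorem repDeg_neg_genPt : (-genPt W = 0 ∧ (1 : ℕ) = 0) ∨ (-genPt W ≠ 0 ∧ ∃ a b : F[X],
    IsRep W (xc W (-genPt W)) a b ∧ b.natDegree < a.natDegree ∧ a.natDegree = 1) :=
  Or.inr ⟨neg_genPt_ne_zero W, X, 1, isRep_xc_neg_genPt W,
    by rw [natDegree_one, natDegree_X]; exact one_pos, natDegree_X⟩

/-- `RepDeg (2Q) 4`: `x(2Q) = Φ₂/Ψ₂²` in lowest terms. [folklore] -/
theorem repDeg_two_genPt : (genPt W + genPt W = 0 ∧ (4 : ℕ) = 0) ∨ (genPt W + genPt W ≠ 0 ∧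
    ∃ a b : F[X], IsRep W (xc W (genPt W + genPt W)) a b ∧ b.natDegree < a.natDegree ∧
      a.natDegree = 4) := by
  have hΦ : (W.Φ 2).natDegree = 4 := by rw [WeierstrassCurve.natDegree_Φ]; norm_num
  exact Or.inr ⟨genPt_add_genPt_ne_zero W, W.Φ 2, W.Ψ₂Sq, isRep_xc_two_genPt W,
    lt_of_le_of_lt W.natDegree_Ψ₂Sq_le (by rw [hΦ]; norm_num), hΦ⟩

/-- `RepDeg (-2Q) 4`. [folklore] -/
theorem repDeg_neg_two_genPt : (-(genPt W + genPt W) = 0 ∧ (4 : ℕ) = 0) ∨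
    (-(genPt W + genPt W) ≠ 0 ∧ ∃ a b : F[X], IsRep W (xc W (-(genPt W + genPt W))) a b ∧
      b.natDegree < a.natDegree ∧ a.natDegree = 4) := by
  have hΦ : (W.Φ 2).natDegree = 4 := by rw [WeierstrassCurve.natDegree_Φ]; norm_num
  refine Or.inr ⟨by rw [Ne, neg_eq_zero]; exact genPt_add_genPt_ne_zero W, W.Φ 2, W.Ψ₂Sq, ?_,
    lt_of_le_of_lt W.natDegree_Ψ₂Sq_le (by rw [hΦ]; norm_num), hΦ⟩
  rw [xc_neg]
  exact isRep_xc_two_genPt W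

/-- **Manin's basic identity for a general point, with the degenerate cases.** If `RepDeg P d`
and the `x`-coordinates of `P ± Q` lie in `F(X)` (are fixed by the negation involution), then
`RepDeg (P + Q) d₁` and `RepDeg (P - Q) d₂` with `d₁ + d₂ = 2d + 2`: in the generic case
`P ∉ {O, ±Q}` this is `step` (Chahal 2021, (10.25)); if `P = O` the neighbours are `±Q` (`d = 1`);
if `P = ±Q` they are `O` (`d = 0`) and `±2Q` (`d = 4`). This is `st_step` of `HasseManin` with
the degree freed from Manin's closed formula.
[cite: Chahal2021, §10.3 Thm. 10.14 (proof, induction step)] -/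
theorem repDeg_step {P : (W.baseChange W.toAffine.FunctionField).toAffine.Point} {d : ℕ}
    (hP : (P = 0 ∧ d = 0) ∨ (P ≠ 0 ∧ ∃ a b : F[X], IsRep W (xc W P) a b ∧
      b.natDegree < a.natDegree ∧ a.natDegree = d))
    (hadd : negL W (xc W (P + genPt W)) = xc W (P + genPt W))
    (hsub : negL W (xc W (P - genPt W)) = xc W (P - genPt W)) :
    ∃ d₁ d₂ : ℕ,
      ((P + genPt W = 0 ∧ d₁ = 0) ∨ (P + genPt W ≠ 0 ∧ ∃ a b : F[X],
        IsRep W (xc W (P + genPt W)) a b ∧ b.natDegree < a.natDegree ∧ a.natDegree = d₁)) ∧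
      ((P - genPt W = 0 ∧ d₂ = 0) ∨ (P - genPt W ≠ 0 ∧ ∃ a b : F[X],
        IsRep W (xc W (P - genPt W)) a b ∧ b.natDegree < a.natDegree ∧ a.natDegree = d₂)) ∧
      d₁ + d₂ = 2 * d + 2 := by
  rcases P with _ | ⟨x₁, y₁, h₁⟩
  · -- `P = O`: the neighbours are `±Q`
    rw [← Point.zero_def] at hP ⊢
    have hd : d = 0 := by
      rcases hP with ⟨-, hd⟩ | ⟨hP, -⟩
      · exact hd
      · exact absurd rfl hP
    refine ⟨1, 1, ?_, ?_, by rw [hd]⟩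
    · rw [zero_add]; exact repDeg_genPt W
    · rw [zero_sub]; exact repDeg_neg_genPt W
  · by_cases hx : x₁ = gT W
    · -- `P = ±Q`
      rcases (Point.X_eq_iff (h₁ := h₁) (h₂ := nonsingular_gT_gS W)).mp hx with hQ | hQ <;>
        rw [← genPt_eq] at hQ <;> rw [hQ] at hP ⊢
      · -- `P = Q`: neighbours `2Q` and `O`
        have hd : d = 1 := repDeg_unique W hP (repDeg_genPt W)
        refine ⟨4, 0, repDeg_two_genPt W, Or.inl ⟨sub_self _, rfl⟩, by rw [hd]⟩
      · -- `P = -Q`: neighbours `O` and `-2Q`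
        have hd : d = 1 := repDeg_unique W hP (repDeg_neg_genPt W)
        refine ⟨0, 4, Or.inl ⟨neg_add_cancel _, rfl⟩, ?_, by rw [hd]⟩
        rw [← neg_add']
        exact repDeg_neg_two_genPt W
    · -- generic case: the basic identity
      obtain ⟨u₁, v₁, hadd'⟩ := exists_isRep_of_negL_eq W hadd
      obtain ⟨u₂, v₂, hsub'⟩ := exists_isRep_of_negL_eq W hsub
      rcases hP with ⟨h, -⟩ | ⟨-, a, b, hrep, hlt, hd⟩
      · exact absurd h (Point.some_ne_zero _)
      rw [xc_some] at hrep
      obtain ⟨hu, -, hv₁, hv₂, -⟩ := step W h₁ hrep hlt hx hadd' hsub'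
      have hne1 : Point.some x₁ y₁ h₁ + genPt W ≠ 0 := by
        rw [genPt_eq, Point.add_of_X_ne hx]; exact Point.some_ne_zero _
      have hne2 : Point.some x₁ y₁ h₁ - genPt W ≠ 0 := by
        rw [genPt_eq, sub_eq_add_neg, Point.neg_some, Point.add_of_X_ne hx]
        exact Point.some_ne_zero _
      exact ⟨u₁.natDegree, u₂.natDegree, Or.inr ⟨hne1, u₁, v₁, hadd', hv₁, rfl⟩,
        Or.inr ⟨hne2, u₂, v₂, hsub', hv₂, rfl⟩, by rw [hu, hd]⟩

/-- **Propagation.** If the `x`-coordinates of all `R + p • Q` lie in `F(X)` and `RepDeg` holds at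
one `p₀`, then every `R + p • Q` has a degree: `RepDeg (R + p • Q) (e p)` for a (unique) function
`e : ℤ → ℕ`, which satisfies Manin's recursion `e (p + 1) + e (p - 1) = 2 e p + 2`.
[cite: Chahal2021, §10.3 Thm. 10.14 (proof)] -/
theorem exists_repDeg_fun {R : (W.baseChange W.toAffine.FunctionField).toAffine.Point}
    (hinv : ∀ p : ℤ, negL W (xc W (R + p • genPt W)) = xc W (R + p • genPt W)) {p₀ : ℤ} {d₀ : ℕ}
    (h₀ : (R + p₀ • genPt W = 0 ∧ d₀ = 0) ∨ (R + p₀ • genPt W ≠ 0 ∧ ∃ a b : F[X],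
      IsRep W (xc W (R + p₀ • genPt W)) a b ∧ b.natDegree < a.natDegree ∧ a.natDegree = d₀)) :
    ∃ e : ℤ → ℕ, (∀ p, (R + p • genPt W = 0 ∧ e p = 0) ∨ (R + p • genPt W ≠ 0 ∧ ∃ a b : F[X],
      IsRep W (xc W (R + p • genPt W)) a b ∧ b.natDegree < a.natDegree ∧ a.natDegree = e p)) ∧
      ∀ p, e (p + 1) + e (p - 1) = 2 * e p + 2 := by
  -- shorthand for the invariant
  set RD : ℤ → ℕ → Prop := fun p d ↦ (R + p • genPt W = 0 ∧ d = 0) ∨ (R + p • genPt W ≠ 0 ∧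
    ∃ a b : F[X], IsRep W (xc W (R + p • genPt W)) a b ∧ b.natDegree < a.natDegree ∧
      a.natDegree = d) with hRD
  have hadd : ∀ p : ℤ, R + p • genPt W + genPt W = R + (p + 1) • genPt W := fun p ↦ by
    rw [add_zsmul, one_zsmul, add_assoc]
  have hsub : ∀ p : ℤ, R + p • genPt W - genPt W = R + (p - 1) • genPt W := fun p ↦ by
    rw [sub_zsmul, one_zsmul, add_sub_assoc, sub_eq_add_neg]
  -- one step in each direction
  have hstep : ∀ p d, RD p d → ∃ d₁ d₂, RD (p + 1) d₁ ∧ RD (p - 1) d₂ ∧ d₁ + d₂ = 2 * d + 2 := by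
    intro p d h
    have h1 := hinv (p + 1)
    have h2 := hinv (p - 1)
    rw [← hadd] at h1
    rw [← hsub] at h2
    obtain ⟨d₁, d₂, H1, H2, H⟩ := repDeg_step W h h1 h2
    rw [hadd] at H1
    rw [hsub] at H2
    exact ⟨d₁, d₂, H1, H2, H⟩
  -- existence everywhere
  have hup : ∀ k : ℕ, ∃ d, RD (p₀ + k) d := by
    intro k
    induction k with
    | zero => exact ⟨d₀, by rw [Nat.cast_zero, add_zero]; exact h₀⟩
    | succ k ih =>
      obtain ⟨d, hd⟩ := ih
      obtain ⟨d₁, -, H1, -, -⟩ := hstep _ _ hd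
      exact ⟨d₁, by rw [Nat.cast_succ, ← add_assoc]; exact H1⟩
  have hdown : ∀ k : ℕ, ∃ d, RD (p₀ - k) d := by
    intro k
    induction k with
    | zero => exact ⟨d₀, by rw [Nat.cast_zero, sub_zero]; exact h₀⟩
    | succ k ih =>
      obtain ⟨d, hd⟩ := ih
      obtain ⟨-, d₂, -, H2, -⟩ := hstep _ _ hd
      exact ⟨d₂, by rw [Nat.cast_succ, ← sub_sub]; exact H2⟩
  have hall : ∀ p, ∃ d, RD p d := by
    intro p
    obtain ⟨k, hk | hk⟩ := Int.eq_nat_or_neg (p - p₀)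
    · obtain ⟨d, hd⟩ := hup k
      exact ⟨d, by rw [show p = p₀ + k by omega]; exact hd⟩
    · obtain ⟨d, hd⟩ := hdown k
      exact ⟨d, by rw [show p = p₀ - k by omega]; exact hd⟩
  choose e he using hall
  refine ⟨e, he, fun p ↦ ?_⟩
  obtain ⟨d₁, d₂, H1, H2, H⟩ := hstep p (e p) (he p)
  rw [repDeg_unique W (he (p + 1)) H1, repDeg_unique W (he (p - 1)) H2, H]

omit [W.IsElliptic] in
/-- **The closed form of Manin's recursion**: a function `e : ℤ → ℕ` with second difference `2`
is `e p = p² + c₁ p + c₀`. [cite: Chahal2021, §10.3 Thm. 10.14 (10.30)] -/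
theorem exists_eq_quadratic_of_rec {e : ℤ → ℕ} (he : ∀ p, e (p + 1) + e (p - 1) = 2 * e p + 2) :
    ∃ c₁ c₀ : ℤ, ∀ p, (e p : ℤ) = p ^ 2 + c₁ * p + c₀ := by
  refine ⟨(e 1 : ℤ) - e 0 - 1, e 0, ?_⟩
  have he' : ∀ p, (e (p + 1) : ℤ) + e (p - 1) = 2 * e p + 2 := fun p ↦ by exact_mod_cast he p
  have hup : ∀ k : ℕ, ((e k : ℤ) = (k : ℤ) ^ 2 + ((e 1 : ℤ) - e 0 - 1) * k + e 0) ∧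
      ((e (k + 1) : ℤ) = ((k : ℤ) + 1) ^ 2 + ((e 1 : ℤ) - e 0 - 1) * (k + 1) + e 0) := by
    intro k
    induction k with
    | zero => constructor <;> push_cast <;> ring
    | succ k ih =>
      refine ⟨by exact_mod_cast ih.2, ?_⟩
      have h := he' (k + 1)
      rw [add_sub_cancel_right] at h
      push_cast at h ih ⊢
      linear_combination h + 2 * ih.2 - ih.1
  have hdown : ∀ k : ℕ, ((e (-k) : ℤ) = (-(k : ℤ)) ^ 2 + ((e 1 : ℤ) - e 0 - 1) * (-k) + e 0) ∧
      ((e (-k + 1) : ℤ) = (-(k : ℤ) + 1) ^ 2 + ((e 1 : ℤ) - e 0 - 1) * (-k + 1) + e 0) := by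
    intro k
    induction k with
    | zero => constructor <;> push_cast <;> ring_nf
    | succ k ih =>
      refine ⟨?_, ?_⟩
      · have h := he' (-k)
        push_cast at h ih ⊢
        have e1 : (-((k : ℤ) + 1)) = -k - 1 := by ring
        rw [e1]
        linear_combination h + 2 * ih.1 - ih.2
      · have e1 : (-((k + 1 : ℕ) : ℤ) + 1) = -(k : ℤ) := by push_cast; ring
        rw [e1]
        exact ih.1
  intro p
  obtain ⟨k, rfl | rfl⟩ := Int.eq_nat_or_neg p
  · exact (hup k).1
  · exact (hdown k).1

end Recursion

/-! ## The anchors `(φ + n) ∘ (φ + m)` and the relation `φ² - aφ + q = 0` over `F(W)` -/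

section Relation

variable (W : WeierstrassCurve F) [W.IsElliptic] [Fintype F]

/-- **The composition anchors.** For `P_n, P_m ≠ O` the point `P₀' + (m + n) • P₀ + (n m) • Q`
(the generic value of `(φ + n) ∘ (φ + m)`, `map_funcAlgHom_maninPt`) satisfies `RepDeg` with
degree `d(n) d(m)`: its `x`-coordinate is `x_n(x_m)`, a reduced fraction whose numerator has degree
`deg a_n · deg a_m` (`isRep_of_mul_aeval_eq`, and Manin's `st_all` — Chahal 2021, Thm. 10.14 —
for `d(n)`, `d(m)`): the degree of a composition of rational maps is the product of the degrees.
[folklore] -/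
theorem exists_repDeg_comp (n m : ℤ) (hn : maninPt W n ≠ 0) (hm : maninPt W m ≠ 0) :
    ∃ D : ℕ, (D : ℤ) = dg W n * dg W m ∧
      ((Point.map (frob W) (frobPt W) + (m + n) • frobPt W + (n * m) • genPt W = 0 ∧ D = 0) ∨
        (Point.map (frob W) (frobPt W) + (m + n) • frobPt W + (n * m) • genPt W ≠ 0 ∧
          ∃ a b : F[X], IsRep W (xc W (Point.map (frob W) (frobPt W) + (m + n) • frobPt W +
            (n * m) • genPt W)) a b ∧ b.natDegree < a.natDegree ∧ a.natDegree = D)) := by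
  -- the data of `P_m`
  rcases hPm : maninPt W m with _ | ⟨x, y, h⟩
  · exact absurd hPm hm
  rcases st_all W m with ⟨h0, -⟩ | ⟨-, am, bm, hrepm, hltm, hdm⟩
  · exact absurd h0 hm
  rw [hPm, xc_some] at hrepm
  have ht : Transcendental F x := transcendental_of_isRep W hrepm hltm
  -- the data of `P_n`
  rcases hPn : maninPt W n with _ | ⟨x', y', h'⟩
  · exact absurd hPn hn
  rcases st_all W n with ⟨h0, -⟩ | ⟨-, an, bn, hrepn, hltn, hdn⟩
  · exact absurd h0 hn
  rw [hPn, xc_some] at hrepn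
  -- the composition
  have hC := map_funcAlgHom_maninPt W hPm ht n
  rw [hPn, Point.map_some] at hC
  refine ⟨an.natDegree * am.natDegree, by push_cast; rw [hdn, hdm], Or.inr ⟨?_, ?_⟩⟩
  · rw [← hC]; exact Point.some_ne_zero _
  have hw : WeierstrassFunctionField.funcAlgHom (V := W.toAffine) x y
      (evalEval_eq_zero_of_nonsingular W h) ht x' * aeval x bn = aeval x an := by
    rw [← funcAlgHom_algebraMap W h ht, ← funcAlgHom_algebraMap W h ht, ← map_mul, hrepn.mul_eq]
  obtain ⟨hrep, hlt, hdeg⟩ := isRep_of_mul_aeval_eq W hrepm hltm hrepn.isCoprime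
    (ne_zero_of_natDegree_gt hltn) hrepn.ne_zero hltn hw
  refine ⟨_, _, ?_, hlt, hdeg⟩
  rw [← hC, xc_some]
  exact hrep

omit [W.IsElliptic] in
/-- `d(-a - n) = d(n)`: Manin's parabola is symmetric about `-a/2`. [folklore] -/
theorem dg_neg_tr_sub (n : ℤ) : dg W (-tr W - n) = dg W n := by
  simp only [dg]; ring

/-- If some `P_n = O` (the Frobenius endomorphism is the integer `-n`), then `d(n) = 0` and the
relation `P₀' - a • P₀ + q • Q = d(n) • Q = O` holds trivially. [folklore] -/
theorem frob_relation_of_maninPt_eq_zero {n : ℤ} (hn : maninPt W n = 0) :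
    Point.map (frob W) (frobPt W) - tr W • frobPt W + (Fintype.card F : ℤ) • genPt W = 0 := by
  have hd : dg W n = 0 := (st_all W n).dg_eq_zero hn
  have hf : frobPt W = -(n • genPt W) := eq_neg_of_add_eq_zero_left hn
  have key : Point.map (frob W) (frobPt W) - tr W • frobPt W + (Fintype.card F : ℤ) • genPt W =
      dg W n • genPt W := by
    rw [hf, map_neg, map_zsmul, map_frob_genPt, hf, dg]
    module
  rw [key, hd, zero_zsmul]

/-- **`φ² - aφ + q = 0` at the generic point** (Silverman, *AEC*, Thm. V.2.3.1(b), proved here by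
Manin's method): in `W(F(W))`, `P₀' - a • P₀ + q • Q = O`, where `Q = (t, s)`, `P₀ = (t^q, s^q)`,
`P₀' = (t^{q²}, s^{q²})` and `a = q + 1 - #W(F)`. Proof: along `p ↦ R + p • Q`, `R = P₀' - a • P₀`,
the degrees `e(p)` satisfy Manin's recursion (`exists_repDeg_fun`), so `e(p) = p² + c₁ p + c₀`;
the composition anchors `(φ + n)(φ - a - n) = R + n(-a - n)` have `e = d(n)² = (n(-a-n) - q)²` at
`n = 0` and at one more `n` (`exists_repDeg_comp`, `st_all`), whence `e(p) = (p - q)²`, `e(q) = 0`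
and `R + q • Q = O`. (If some `P_n = O` the relation is trivial, `frob_relation_of_maninPt_eq_zero`.)
[cite: SilvermanAEC2009, Thm. V.2.3.1(b)] -/
theorem frob_relation :
    Point.map (frob W) (frobPt W) - tr W • frobPt W + (Fintype.card F : ℤ) • genPt W = 0 := by
  by_cases hint : ∃ n : ℤ, maninPt W n = 0
  · obtain ⟨n, hn⟩ := hint
    exact frob_relation_of_maninPt_eq_zero W hn
  push Not at hint
  set a := tr W with ha
  set q : ℤ := (Fintype.card F : ℤ) with hq
  set R := Point.map (frob W) (frobPt W) + (-a) • frobPt W with hR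
  -- rewrite the goal as `R + q • Q = 0`
  suffices hgoal : R + q • genPt W = 0 by
    rw [hR, neg_zsmul, ← sub_eq_add_neg] at hgoal
    exact hgoal
  -- invariance of the `x`-coordinates along the sequence
  have hinv : ∀ p : ℤ, negL W (xc W (R + p • genPt W)) = xc W (R + p • genPt W) :=
    fun p ↦ negL_xc_frobPt₂ W (-a) p
  -- first anchor: `n = 0`, `m = -a`, at `p = 0`, degree `q · q`
  obtain ⟨D₁, hD₁, h₁⟩ := exists_repDeg_comp W 0 (-a) (hint 0) (hint (-a))
  have e1 : Point.map (frob W) (frobPt W) + (-a + 0) • frobPt W + (0 * -a) • genPt W =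
      R + (0 : ℤ) • genPt W := by
    rw [add_zero, zero_mul]
  rw [e1] at h₁
  obtain ⟨e, he, hrec⟩ := exists_repDeg_fun W hinv h₁
  obtain ⟨c₁, c₀, hquad⟩ := exists_eq_quadratic_of_rec hrec
  -- second anchor: `n = n₂`, `m = -a - n₂` with `p₂ = n₂ (-a - n₂) ≠ 0`
  obtain ⟨n₂, hn₂⟩ : ∃ n₂ : ℤ, n₂ * (-a - n₂) ≠ 0 := by
    by_cases h1 : a = -1
    · exact ⟨-1, by rw [h1]; norm_num⟩
    · exact ⟨1, by rw [one_mul]; omega⟩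
  obtain ⟨D₂, hD₂, h₂⟩ := exists_repDeg_comp W n₂ (-a - n₂) (hint n₂) (hint (-a - n₂))
  have e2 : Point.map (frob W) (frobPt W) + (-a - n₂ + n₂) • frobPt W + (n₂ * (-a - n₂)) • genPt W =
      R + (n₂ * (-a - n₂)) • genPt W := by
    rw [sub_add_cancel]
  rw [e2] at h₂
  -- the two anchor values pin down `c₁ = -2q`, `c₀ = q²`
  have hv0 : (e 0 : ℤ) = q * q := by
    rw [repDeg_unique W (he 0) h₁, hD₁, dg_zero, show -a = -tr W - 0 by rw [ha]; ring,
      dg_neg_tr_sub, dg_zero]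
  have hv2 : (e (n₂ * (-a - n₂)) : ℤ) = dg W n₂ * dg W n₂ := by
    rw [repDeg_unique W (he _) h₂, hD₂, ha, dg_neg_tr_sub]
  have hc₀ : c₀ = q * q := by
    have h := hquad 0
    rw [hv0] at h
    linear_combination -h
  have hp₂ : n₂ * (-a - n₂) = q - dg W n₂ := by rw [dg, ← ha, ← hq]; ring
  have hc₁ : c₁ = -2 * q := by
    have h := hquad (n₂ * (-a - n₂))
    rw [hv2, hc₀, hp₂] at h
    rw [hp₂] at hn₂
    have h' : (q - dg W n₂) * (2 * q + c₁) = 0 := by linear_combination -h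
    rcases mul_eq_zero.mp h' with h0 | h0
    · exact absurd h0 hn₂
    · linear_combination h0
  -- hence `e q = 0` and `R + q • Q = O`
  have hvq : e q = 0 := by
    have h := hquad q
    rw [hc₁, hc₀] at h
    exact_mod_cast (by linear_combination h : (e q : ℤ) = 0)
  rcases he q with ⟨h, -⟩ | ⟨-, a', b', -, hlt, hd⟩
  · exact h
  · rw [hvq] at hd; omega

end Relation



end Literature.NumberTheory.EllipticCurves.HasseManin

/-! ## From the generic point to `E(k̄)` and `End(E)` -/

namespace WeierstrassCurve

open Literature.NumberTheory.EllipticCurves Literature.NumberTheory.EllipticCurves.HasseManin Literature.NumberTheory.EllipticCurves.WeierstrassFunctionField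

variable {K : Type u} [Field K] (W : WeierstrassCurve K) [W.IsElliptic]

omit [W.IsElliptic] in
/-- `x ∈ K̄(E)` is transcendental over the base field `k`. [folklore] -/
theorem transcendental_genX_base : Transcendental K W.genX :=
  (transcendental_genX W).of_tower_top K

/-- **The embedding `k(E) → K̄(E)`** (`t ↦ x`, `s ↦ y`, the `funcAlgHom` of the generic point of
`K̄(E)`) maps the generic point `Q = (t, s)` of `E(k(E))` to the generic point `(x, y)` of
`E(K̄(E))`. [folklore] -/
theorem map_funcAlgHom_genX_genPt :
    Affine.Point.map (funcAlgHom (V := W.toAffine) W.genX W.genY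
      (evalEval_eq_zero_of_nonsingular W (nonsingular_genX_genY W)) (transcendental_genX_base W))
      (genPt W) = W.genericPoint := by
  rw [genPt_eq, Affine.Point.map_some, genericPoint]
  congr 1
  · exact funcAlgHom_xF _ _ _ _
  · exact funcAlgHom_yF _ _ _ _

variable [Fintype K]

/-- The embedding `k(E) → K̄(E)` intertwines the `q`-power Frobenius maps on points. [folklore] -/
theorem map_funcAlgHom_genX_map_frob (P : (W.baseChange W.toAffine.FunctionField).toAffine.Point) :
    Affine.Point.map (funcAlgHom (V := W.toAffine) W.genX W.genY
      (evalEval_eq_zero_of_nonsingular W (nonsingular_genX_genY W)) (transcendental_genX_base W))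
      (Affine.Point.map (frob W) P) =
    W.frobeniusPoint 1 (Affine.Point.map (funcAlgHom (V := W.toAffine) W.genX W.genY
      (evalEval_eq_zero_of_nonsingular W (nonsingular_genX_genY W)) (transcendental_genX_base W))
      P) := by
  rcases P with _ | ⟨x₁, y₁, h₁⟩
  · rfl
  · rw [Affine.Point.map_some, Affine.Point.map_some, Affine.Point.map_some, frobeniusPoint_some]
    congr 1
    · rw [frob_apply, map_pow, pow_one, Nat.card_eq_fintype_card]
    · rw [frob_apply, map_pow, pow_one, Nat.card_eq_fintype_card]

/-- **`φ² - aφ + q = 0` at the generic point of `E(K̄(E))`**: with `(x, y)` the generic point and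
`Frob_q` the `q`-power Frobenius on `E(K̄(E))`,
`Frob_q (Frob_q (x, y)) - a • Frob_q (x, y) + q • (x, y) = O`, `a = q + 1 - #E(k)`
(`Literature.NumberTheory.EllipticCurves.HasseManin.frob_relation` transported along `k(E) → K̄(E)`).
[cite: SilvermanAEC2009, Thm. V.2.3.1(b)] -/
theorem frobeniusPoint_genericPoint_relation :
    W.frobeniusPoint 1 (W.frobeniusPoint 1 W.genericPoint) - tr W • W.frobeniusPoint 1 W.genericPoint +
      (Fintype.card K : ℤ) • W.genericPoint = 0 := by
  have h := congrArg (Affine.Point.map (funcAlgHom (V := W.toAffine) W.genX W.genY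
    (evalEval_eq_zero_of_nonsingular W (nonsingular_genX_genY W)) (transcendental_genX_base W)))
    (frob_relation W)
  rwa [map_zero, map_add, map_sub, map_zsmul, map_zsmul, map_funcAlgHom_genX_map_frob,
    ← map_frob_genPt, map_funcAlgHom_genX_map_frob, map_funcAlgHom_genX_genPt] at h

omit [Fintype K] in
/-- Translations commute with the Frobenius on `E(K̄(E))` (both are induced by ring
endomorphisms of `K̄(E)`, which commute: `τ (z ^ q) = (τ z) ^ q`). [folklore] -/
theorem map_transAlgHom_frobeniusPoint [Finite K] (T : W.geomPoints) (m : ℕ)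
    (P : (W.baseChange W.geomFunctionField).toAffine.Point) :
    Affine.Point.map (W' := W) (W.transAlgHom T) (W.frobeniusPoint m P) =
      W.frobeniusPoint m (Affine.Point.map (W' := W) (W.transAlgHom T) P) := by
  rcases P with _ | ⟨x₁, y₁, h₁⟩
  · rfl
  · rw [frobeniusPoint_some, Affine.Point.map_some, Affine.Point.map_some, frobeniusPoint_some]
    congr 1 <;> rw [map_pow]

omit [Fintype K] [W.IsElliptic] in
/-- **The Frobenius of `E(K̄(E))` acts on constant points as the arithmetic Frobenius `σ_q`**:
`Frob_q (T) = σ_q • T` for `T ∈ E(k̄)`. [folklore] -/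
theorem frobeniusPoint_one_constPoint [Finite K] {σ : Field.absoluteGaloisGroup K}
    (hσ : ∀ x : AlgebraicClosure K, σ • x = x ^ Nat.card K) (T : W.geomPoints) :
    W.frobeniusPoint 1 (W.constPoint T) = W.constPoint (σ • T) := by
  classical
  rcases eq_or_ne T 0 with rfl | hT
  · rw [smul_zero, map_zero, map_zero]
  · obtain ⟨a, b, h, rfl⟩ := geomPoints.exists_eq_some hT
    have e : σ • (show W.geomPoints from Affine.Point.some a b h) = Affine.Point.map
        ((show AlgebraicClosure K ≃ₐ[K] AlgebraicClosure K from σ) :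
          AlgebraicClosure K →ₐ[K] AlgebraicClosure K) (.some a b h) := rfl
    rw [e, Affine.Point.map_some, constPoint_some, constPoint_some, frobeniusPoint_some]
    congr 1
    · rw [pow_one, ← map_pow]; exact congrArg _ (hσ a).symm
    · rw [pow_one, ← map_pow]; exact congrArg _ (hσ b).symm

/-- **`σ_q² T - a • σ_q T + q • T = O` for every `T ∈ E(k̄)`** (`a = q + 1 - #E(k)`): the
Frobenius endomorphism `π` of an elliptic curve over a finite field with `q` elements satisfies
`π² - aπ + q = 0` pointwise. From the generic relation (`frobeniusPoint_genericPoint_relation`)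
by applying the translation `τ_T^*` (`transAlgHom`), which moves the generic point to
`(x, y) + T` and fixes the relation's shape, and reading off the constant part
(`constPoint` is injective). Elementary proof (Manin's method); Silverman proves it via
`det = deg` on the Tate module. [cite: SilvermanAEC2009, Thm. V.2.3.1(b)] -/
theorem frobenius_sq_sub_trace_smul_add_card_smul {σ : Field.absoluteGaloisGroup K}
    (hσ : ∀ x : AlgebraicClosure K, σ • x = x ^ Nat.card K) (T : W.geomPoints) :
    σ • (σ • T) - tr W • (σ • T) + (Fintype.card K : ℤ) • T = 0 := by
  have h0 := frobeniusPoint_genericPoint_relation W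
  have h := congrArg (Affine.Point.map (W' := W) (W.transAlgHom T)) h0
  rw [map_zero, map_add, map_sub, map_zsmul, map_zsmul, map_transAlgHom_frobeniusPoint,
    map_transAlgHom_frobeniusPoint, map_transAlgHom_genericPoint, map_add, map_add,
    frobeniusPoint_one_constPoint W hσ, frobeniusPoint_one_constPoint W hσ] at h
  have hc : W.constPoint (σ • (σ • T) - tr W • (σ • T) + (Fintype.card K : ℤ) • T) = 0 := by
    rw [map_add, map_sub, map_zsmul, map_zsmul]
    have key : W.constPoint (σ • (σ • T)) - tr W • W.constPoint (σ • T) +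
        (Fintype.card K : ℤ) • W.constPoint T =
      (W.frobeniusPoint 1 (W.frobeniusPoint 1 W.genericPoint) + W.constPoint (σ • (σ • T)) -
          tr W • (W.frobeniusPoint 1 W.genericPoint + W.constPoint (σ • T)) +
          (Fintype.card K : ℤ) • (W.genericPoint + W.constPoint T)) -
        (W.frobeniusPoint 1 (W.frobeniusPoint 1 W.genericPoint) -
          tr W • W.frobeniusPoint 1 W.genericPoint + (Fintype.card K : ℤ) • W.genericPoint) := by
      module
    rw [key, h, h0, sub_self]
  exact (map_eq_zero_iff _ constPoint_injective).mp hc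

omit [Fintype K] in
/-- **Silverman, *AEC*, Thm. V.2.3.1(b) in `End_k(E)`, proved:** the Frobenius endomorphism
`π = frobeniusIsogeny W hσ` of an elliptic curve over a finite field `k` with `q` elements
satisfies `π² - aπ + q = 0` in the endomorphism ring `End_k(E)`, where `a = q + 1 - #E(k)`
(`#E(k) = Nat.card W.toAffine.Point`, counting `O`). In particular `π` is algebraic over `ℤ`.
The proof is elementary (Manin's degree recursion over `k(E)`, `Literature.NumberTheory.EllipticCurves.HasseManin.frob_relation`),
using neither the dual isogeny nor the Weil pairing. [cite: SilvermanAEC2009, Thm. V.2.3.1(b)] -/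
theorem aeval_frobeniusIsogeny_eq_zero [Finite K] {σ : Field.absoluteGaloisGroup K}
    (hσ : ∀ x : AlgebraicClosure K, σ • x = x ^ Nat.card K) :
    Polynomial.aeval (⟨(W.frobeniusIsogeny hσ).toAddMonoidHom,
        (W.frobeniusIsogeny hσ).toAddMonoidHom_mem_endRing⟩ : W.endRing)
      (X ^ 2 - C ((Nat.card K : ℤ) + 1 - Nat.card W.toAffine.Point) * X + C (Nat.card K : ℤ)) =
        0 := by
  letI := Fintype.ofFinite K
  apply Subtype.ext
  rw [map_add, map_sub, map_mul, Polynomial.aeval_C, Polynomial.aeval_C, map_pow,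
    Polynomial.aeval_X, algebraMap_int_eq, eq_intCast, eq_intCast]
  refine AddMonoidHom.ext fun T ↦ ?_
  have h := frobenius_sq_sub_trace_smul_add_card_smul W hσ T
  rw [tr, natCast_zsmul, ← Nat.card_eq_fintype_card] at h
  simp only [sq, Int.cast_natCast, ZeroMemClass.coe_zero]
  exact h

end WeierstrassCurve
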